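import Literature.MathematicalPhysics.QuantumFieldTheory.Balaban1983to89.B9Thm37GlueTorus

/-!
# `Balaban1983to89.B9Thm37GlueTorusE123` — entries 1, 2, 3 of (3.42) for G′ in the ONE-SCALE ℓ¹ torus model
# (sibling leaf of `B9Thm37GlueTorus`; own lineage pv21; imports `B9Thm37GlueTorus` only; modifies nothing)

References (bib keys; the tags below cite only these):
* [B9] = `Balaban1985BackgroundPropagators` — T. Bałaban, *Propagators for lattice gauge theories in a background
  field*, Commun. Math. Phys. 99 (1985) 389–434.
* [4] = `Balaban1984PropagatorsII` — T. Bałaban, *Propagators and renormalization transformations for lattice gauge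
  theories. II*, Commun. Math. Phys. 96 (1984) 223–250.
* [3] = `Balaban1984PropagatorsI` — T. Bałaban, *Propagators and renormalization transformations for lattice gauge
  theories. I*, Commun. Math. Phys. 95 (1984) 17–40.

THE PRINTED LOCI (all certified in the headers of modules this file imports; nothing new is quoted here).
[B9] p. 397 (3.42) (the four entries |Gλ|, |∇_U Gλ|, |G∇*_U λ|, |Δ_U Gλ| with scale prefactors (L^jη)², L^jη,
L^jη, 1 — named in the headers of `B9` and `B9Thm37Glue`) and p. 409 (3.87)–(3.90) (header of `B9Thm37GlueSz`);
[4] p. 231 (2.46), p. 224 (2.4), p. 225 (2.14) with «(Q′₀λ)(x) = λ(x), x ∈ Λ₀», p. 234 Lemma 2.1 (2.61)/(2.63);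
[3] p. 36 (1.118) — as listed in the header of `B9Thm37GlueTorus`.

THE POINT (value = kernel-checked bookkeeping, NOT summit progress).  `B9Thm37GlueTorus.thm37_entry4_l1_diag`
is ENTRY 4 of (3.42) (the Δ_UG′ bound, Δ_U = D\*D, weight 1) for G′ = (Δ_U + Q′\*aQ′)^{−1} in the one-scale torus model with
every geometric / partition-of-unity / random-walk / Q hypothesis of the pv21 glue discharged by name.  The glue
lineage proves the other three entries at the same abstraction (`B9Thm37GlueSz.thm37_entry{1,2,3}_of_342_lattice_
of_387_sz`: |G′| with weight (L^jη)², |∇G′| and |G′∇*| with weight L^jη); THIS FILE specialises them to the same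
model: `thm37_entry1_l1_diag`, `thm37_entry2_l1_diag`, `thm37_entry3_l1_diag`, on the one-scale geometry
`torusGeom N η L M` (ℓ¹ torus distance, length η), identity chart, the b05 partition of unity `hSU`, nearest-
neighbour bonds with constant weight c₀, and the one-scale Q (`Qf := mulOp q`, K_Q := 0, κ_Q := 0).  Three more
one-scale binders are discharged on the way (§1): `hSY_l1` (entry 2: h_□(x + e_μ) ≠ 0 puts the bond block — the
source point x — into the 1-neighbourhood S′_□, so for entry 2 the located support is S′_□ and N = 7^d),
`hV₃_l1` (entry 2: θ_□ Σ_{y ∈ S′_□, d ≤ ρ} (L^{j_y}η)² ≤ κ₄·L^{j_a}η with κ₄ = |c₀|(4d/M₀)(2⌊ρ⌋+1)^d η = v₁),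
`hC₁_l1` (entry 3: θ_□·#{y ∈ S′_□ : d(y, b) ≤ ρ}·L^{j_b}η ≤ w₁ = v₁, by the torus ball count round b) and the
trivial `hcomp` (C_ℓ = 1: all lengths are η), `hsym`, `hlenpos` (needs 0 < η), `hcolQ` (K_Q = 0), `hQt`
(`isTransposePair_mulOp`).  REMAINING HYPOTHESES (NOT asserted), per entry: the torus/cube compatibility
(1 ≤ M₀ ∣ N_i, 2M₀ ≤ N_i); `hRm`; the numeric ranges (entry 3: 0 < α ≤ ½ for the rate (1 − 2α)δ₀, and 0 < η);
the located smallness `hsmall` (explicit; entry 3 has the (1 + #Cp)-shape of `B9Thm37GlueSz`); Corollary 3.6 for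
the G′_□ (`h342_1`, `h342_2`; entry 3: `h342_1`, `h342_3`); entry 3: the symmetry `hG` of the G′_□; `hloc`; `hinv`.

NOT ASSERTED.  Everything listed as remaining; scales j ≥ 1; optimal constants (5^d, 7^d, (2⌊ρ⌋+1)^d, 4d, 52d are
worst cases); that the four entries together are print's Theorem 3.7 (print's (3.42) is for the multiscale G′(Ω)
with the localisation data this model does not carry).
-/

namespace Literature.MathematicalPhysics.QuantumFieldTheory.Balaban1983to89.B9Thm37GlueTorusE123

open Finset B6RandomWalk B6RandomWalkHom B9Thm37Sum B9Thm34Ext B9Thm37Glue B9Thm37GlueT B9Thm37GlueSt B9Thm37GlueSz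
open B9Thm37GluePU B9Thm37GlueChart B9Thm37GlueTorus
open B5TorusCover (UT Ctr ctrU)
open B5SmoothPartition (hSU)
open B5Leibniz121 (up dist_up_le)

noncomputable section

variable {d : ℕ} {N : Fin d → ℕ} [∀ i, NeZero (N i)]

/-! ## §1  Three more one-scale binders: `hSY` and `hV₃` (entry 2), `hC₁` (entry 3) -/

section Binders

variable {Cp : Type} (η L M : ℝ)

/-- **The binder `hSY` of entry 2** in the one-scale model: if h_z(x + e_μ) ≠ 0 then x + e_μ lies in the open cube
□_z, hence the bond block (the source point x, one unit step away) lies in the 1-neighbourhood `S′_z` of radius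
M₀ + 1. [cite: Balaban1984PropagatorsI, (1.118) p.36; Balaban1985BackgroundPropagators, (3.3) p.391] -/
theorem hSY_l1 {M₀ : ℕ} (hM : 1 ≤ M₀) :
    ∀ (z : Ctr N M₀) (v : (UT N × Fin d) × Cp), hSU N M₀ z (btgt v.1) ≠ 0 →
      cblkY (chart0 N η L M) v ∈ Sball (chart0 N η L M) M₀ (M₀ + 1) z := by
  rintro z ⟨⟨x, μ⟩, k⟩ hne
  have hu : dist (up x μ) (ctrU N M₀ z) < M₀ := by
    by_contra hfar
    exact hne (hSU_eq_zero_of_far hM (not_lt.mp hfar))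
  have hx : dist x (ctrU N M₀ z) < M₀ + 1 :=
    calc dist x (ctrU N M₀ z) ≤ dist x (up x μ) + dist (up x μ) (ctrU N M₀ z) := dist_triangle _ _ _
      _ < 1 + M₀ := add_lt_add_of_le_of_lt (dist_up_le x μ) hu
      _ = M₀ + 1 := add_comm _ _
  have hrw : cblkY (chart0 N η L M) ((x, μ), k) = chart0 N η L M x := rfl
  rw [hrw, mem_Sball_iff (chart0_injective η L M)]
  exact hx

/-- **The binder `hV₃` of entry 2** in the one-scale model, with κ₄ := |c₀|(4d/M₀)(2⌊ρ⌋+1)^d·η (= v₁): all lengths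
are η, so θ_□ Σ_{y ∈ S′_□, d(a,y) ≤ ρ} (len y)² = η·(θ_□ Σ len y) ≤ η·v₁ = κ₄·len a. [cite: Balaban1985BackgroundPropagators, (3.89) p.409; Balaban1984PropagatorsII, (2.44) p.230] -/
theorem hV₃_l1 (hη : 0 ≤ η) {M₀ : ℕ} {ρ : ℝ} (hρ : 0 ≤ ρ) (c₀ : ℝ) :
    ∀ (z : Ctr N M₀) (a : (torusGeom N η L M).Site), a ∈ Sball (chart0 N η L M) M₀ (M₀ + 1) z →
      |c₀| * (4 * d / (M₀ : ℝ)) *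
          ∑ y ∈ (Sball (chart0 N η L M) M₀ (M₀ + 1) z).filter (fun y => (torusGeom N η L M).dist a y ≤ ρ),
            (torusGeom N η L M).len y ^ 2 ≤
        |c₀| * (4 * d / (M₀ : ℝ)) * ((2 * ⌊ρ⌋₊ + 1 : ℝ) ^ d * η) * (torusGeom N η L M).len a := by
  intro z a ha
  have h1 := hV₁_of_ge (hge_chart0 η L M) hη (len_chart0 η L M) hρ c₀ z a ha
  have hsq : ∑ y ∈ (Sball (chart0 N η L M) M₀ (M₀ + 1) z).filter (fun y => (torusGeom N η L M).dist a y ≤ ρ),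
      (torusGeom N η L M).len y ^ 2 =
      η * ∑ y ∈ (Sball (chart0 N η L M) M₀ (M₀ + 1) z).filter (fun y => (torusGeom N η L M).dist a y ≤ ρ),
        (torusGeom N η L M).len y := by
    rw [Finset.mul_sum]
    exact Finset.sum_congr rfl fun y _ => by rw [len_torusGeom, sq]
  rw [hsq, len_torusGeom]
  calc |c₀| * (4 * d / (M₀ : ℝ)) * (η * ∑ y ∈ (Sball (chart0 N η L M) M₀ (M₀ + 1) z).filter
          (fun y => (torusGeom N η L M).dist a y ≤ ρ), (torusGeom N η L M).len y)
        = η * (|c₀| * (4 * d / (M₀ : ℝ)) * ∑ y ∈ (Sball (chart0 N η L M) M₀ (M₀ + 1) z).filter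
          (fun y => (torusGeom N η L M).dist a y ≤ ρ), (torusGeom N η L M).len y) := by ring
    _ ≤ η * (|c₀| * (4 * d / (M₀ : ℝ)) * ((2 * ⌊ρ⌋₊ + 1 : ℝ) ^ d * η)) := mul_le_mul_of_nonneg_left h1 hη
    _ = |c₀| * (4 * d / (M₀ : ℝ)) * ((2 * ⌊ρ⌋₊ + 1 : ℝ) ^ d * η) * η := mul_comm _ _

/-- **The binder `hC₁` of entry 3** in the one-scale model, with w₁ := |c₀|(4d/M₀)(2⌊ρ⌋+1)^d·η (= v₁): the sites of
`S′_z` within ℓ¹-distance ρ of b lie in the sup-ball of radius ρ round b, counted by `ballCard_UT_le`.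
[cite: Balaban1985BackgroundPropagators, (3.89) p.409; Balaban1984PropagatorsII, (2.44) p.230 + (2.46) p.231] -/
theorem hC₁_l1 (hη : 0 ≤ η) {M₀ : ℕ} {ρ : ℝ} (hρ : 0 ≤ ρ) (c₀ : ℝ) :
    ∀ (z : Ctr N M₀) (b : (torusGeom N η L M).Site), b ∈ Sball (chart0 N η L M) M₀ (M₀ + 1) z →
      |c₀| * (4 * d / (M₀ : ℝ)) *
          (((Sball (chart0 N η L M) M₀ (M₀ + 1) z).filter (fun y => (torusGeom N η L M).dist y b ≤ ρ)).card : ℝ) *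
          (torusGeom N η L M).len b ≤
        |c₀| * (4 * d / (M₀ : ℝ)) * ((2 * ⌊ρ⌋₊ + 1 : ℝ) ^ d * η) := by
  intro z b _
  have hcard : (((Sball (chart0 N η L M) M₀ (M₀ + 1) z).filter
      (fun y => (torusGeom N η L M).dist y b ≤ ρ)).card : ℝ) ≤ (2 * ⌊ρ⌋₊ + 1 : ℝ) ^ d :=
    calc (((Sball (chart0 N η L M) M₀ (M₀ + 1) z).filter (fun y => (torusGeom N η L M).dist y b ≤ ρ)).card : ℝ)
        ≤ ((Finset.univ.filter fun w : UT N => dist b w ≤ ρ).card : ℝ) := by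
          exact_mod_cast Finset.card_le_card fun y hy => by
            rw [Finset.mem_filter] at hy ⊢
            refine ⟨Finset.mem_univ _, ?_⟩
            rw [dist_comm]
            exact (dist_le_tdist1 y b).trans hy.2
      _ ≤ (2 * ⌊ρ⌋₊ + 1 : ℝ) ^ d := ballCard_UT_le b hρ
  rw [len_torusGeom]
  calc |c₀| * (4 * d / (M₀ : ℝ)) * (((Sball (chart0 N η L M) M₀ (M₀ + 1) z).filter
          (fun y => (torusGeom N η L M).dist y b ≤ ρ)).card : ℝ) * η
        = |c₀| * (4 * d / (M₀ : ℝ)) * ((((Sball (chart0 N η L M) M₀ (M₀ + 1) z).filter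
          (fun y => (torusGeom N η L M).dist y b ≤ ρ)).card : ℝ) * η) := by ring
    _ ≤ |c₀| * (4 * d / (M₀ : ℝ)) * ((2 * ⌊ρ⌋₊ + 1 : ℝ) ^ d * η) :=
          mul_le_mul_of_nonneg_left (mul_le_mul_of_nonneg_right hcard hη) (by positivity)

/-- `hcomp` with C_ℓ = 1: all lengths of the one-scale geometry are η. [cite: Balaban1985BackgroundPropagators, (3.41) p.397] -/
theorem hcomp_l1 {M₀ : ℕ} : ∀ (z : Ctr N M₀) (a b : (torusGeom N η L M).Site),
    a ∈ Sball (chart0 N η L M) M₀ M₀ z → b ∈ Sball (chart0 N η L M) M₀ (M₀ + 1) z →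
      (torusGeom N η L M).len a ≤ 1 * (torusGeom N η L M).len b := fun z a b _ _ => by
  rw [len_torusGeom, len_torusGeom, one_mul]

/-- `hsym`: the ℓ¹ torus distance is symmetric. [cite: Balaban1984PropagatorsII, (2.46) p.231] -/
theorem hsym_torusGeom : ∀ y y' : (torusGeom N η L M).Site, (torusGeom N η L M).dist y y' =
    (torusGeom N η L M).dist y' y := fun y y' => tdist1_comm y y'

/-- `hlenpos`: for η > 0 every length of the one-scale geometry is positive. [cite: Balaban1985BackgroundPropagators, (3.41) p.397] -/
theorem hlenpos_torusGeom (hη : 0 < η) : ∀ y : (torusGeom N η L M).Site, 0 < (torusGeom N η L M).len y :=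
  fun y => by rw [len_torusGeom]; exact hη

end Binders

/-! ## §2  Entry 1 of (3.42): |G′| with weight η² -/

section Entry1

variable {Cp : Type}

/-- **Entry 1 of (3.42) for G′ = (Δ_U + Q′\*aQ′)^{−1} IN THE ONE-SCALE ℓ¹ TORUS MODEL** =
`B9Thm37GlueSz.thm37_entry1_of_342_lattice_of_387_sz` at `g := torusGeom N η L M`, identity chart, the b05
partition of unity, nearest-neighbour bonds of constant weight c₀, S_□ / S′_□ := the chart balls of radii M₀, M₀ + 1
(N = 5^d, N′ = 7^d), θ_□ = |c₀|4d/M₀, θ_{2,□} = c₀²52d/M₀², v₁ = θ(2⌊ρ⌋+1)^dη, v₂ = θ₂η², the one-scale Q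
(`Qf := mulOp q`, K_Q := 0, κ_Q := 0) — every geometric / PU / random-walk / Q binder discharged BY NAME.
Remaining hypotheses (NOT asserted): compatibility, `hRm`, ranges, `hsmall`, Cor. 3.6 (`h342_1`, `h342_2`), `hloc`,
`hinv`. [cite: Balaban1985BackgroundPropagators, Thm 3.7 (3.87)–(3.90) pp.408–410 + (3.42) p.397; Balaban1984PropagatorsII, (2.14) p.225 + Lemma 2.1 p.234] -/
theorem thm37_entry1_l1_diag [Fintype Cp] [DecidableEq Cp] {M₀ : ℕ} (hM : 1 ≤ M₀) (hdiv : ∀ i, M₀ ∣ N i)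
    (h2N : ∀ i, 2 * M₀ ≤ N i) (η L M R : ℝ) (H : Prop) (hη : 0 ≤ η) (c₀ : ℝ)
    (Rm : UT N × Fin d → Cp → Cp → ℝ) (q : UT N × Cp → ℝ) (δ₀ α ρ B₀ : ℝ) {G' : Module.End ℝ (UT N × Cp → ℝ)}
    (hRm : ∀ b i j, ∑ k, Rm b k i * Rm b k j = if i = j then 1 else 0)
    (hB₀ : 0 ≤ B₀) (hδ₀ : 0 < δ₀) (hα : 0 < α) (hα1 : α ≤ 1) (hρ : 1 ≤ ρ)
    (hsmall : (7 : ℝ) ^ d * (B₀ * Real.exp (δ₀ * ρ) *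
        ((d + d * Fintype.card Cp : ℝ) * (|c₀| * (4 * d / (M₀ : ℝ)) * ((2 * ⌊ρ⌋₊ + 1 : ℝ) ^ d * η)) +
          c₀ ^ 2 * (52 * d / (M₀ : ℝ) ^ 2) * η ^ 2)) * B6.c1 d δ₀ α < 1)
    {Gsq : Ctr N M₀ → Module.End ℝ (UT N × Cp → ℝ)}
    (h342_1 : ∀ i, HasMajorant (g := toB6 (torusGeom N η L M) R H) (cblk (chart0 N η L M)) (Gsq i)
      (fun a b => B₀ * η ^ 2 * Real.exp (-(δ₀ * tdist1 N a b))))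
    (h342_2 : ∀ i, HasMajorantHom (g := toB6 (torusGeom N η L M) R H) (cblk (chart0 N η L M))
      (cblkY (chart0 N η L M)) (covD bsrc btgt (fun _ : UT N × Fin d => c₀) Rm ∘ₗ Gsq i)
      (fun a b => B₀ * η * Real.exp (-(δ₀ * tdist1 N a b))))
    (hloc : ∀ i, mulOp (hSU N M₀ i ∘ Prod.fst) *
      (covDT bsrc btgt (fun _ : UT N × Fin d => c₀) Rm ∘ₗ covD bsrc btgt (fun _ : UT N × Fin d => c₀) Rm +
        mulOp q) *
      Gsq i * mulOp (hSU N M₀ i ∘ Prod.fst) = mulOp (hSU N M₀ i ∘ Prod.fst) * mulOp (hSU N M₀ i ∘ Prod.fst))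
    (hinv : G' * (covDT bsrc btgt (fun _ : UT N × Fin d => c₀) Rm ∘ₗ
      covD bsrc btgt (fun _ : UT N × Fin d => c₀) Rm + mulOp q) = 1) :
    HasMajorant (g := toB6 (torusGeom N η L M) R H) (cblk (chart0 N η L M)) G'
      (fun (a b : UT N) => (5 : ℝ) ^ d * B₀ * B6.c1 d δ₀ α *
        (1 - (7 : ℝ) ^ d * (B₀ * Real.exp (δ₀ * ρ) *
          ((d + d * Fintype.card Cp : ℝ) * (|c₀| * (4 * d / (M₀ : ℝ)) * ((2 * ⌊ρ⌋₊ + 1 : ℝ) ^ d * η)) +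
            c₀ ^ 2 * (52 * d / (M₀ : ℝ) ^ 2) * η ^ 2)) * B6.c1 d δ₀ α)⁻¹ * η ^ 2 *
        Real.exp (-((1 - α) * δ₀ * tdist1 N a b))) := by
  have hαδ : 0 ≤ (1 - α) * δ₀ := mul_nonneg (by linarith) hδ₀.le
  have hsmall' : (7 : ℝ) ^ d * (B₀ * Real.exp (δ₀ * ρ) *
      ((d + d * Fintype.card Cp : ℝ) * (|c₀| * (4 * d / (M₀ : ℝ)) * ((2 * ⌊ρ⌋₊ + 1 : ℝ) ^ d * η)) +
        (c₀ ^ 2 * (52 * d / (M₀ : ℝ) ^ 2) * η ^ 2 + 0))) * B6.c1 d δ₀ α < 1 := by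
    rw [add_zero]; exact hsmall
  have hrowQ : ∀ (i : Ctr N M₀) (a : (torusGeom N η L M).Site),
      ∑ y'' : (torusGeom N η L M).Site, (fun (_ : Ctr N M₀) (_ _ : (torusGeom N η L M).Site) => (0 : ℝ)) i a y'' *
          (torusGeom N η L M).len y'' ^ 2 ≤
        if a ∈ Sball (chart0 N η L M) M₀ (M₀ + 1) i then (0 : ℝ) else 0 := by
    intro i a
    rw [ite_self]
    exact le_of_eq (Finset.sum_eq_zero fun _ _ => by rw [zero_mul])
  have h342_1' : ∀ i, HasMajorant (g := toB6 (torusGeom N η L M) R H) (cblk (chart0 N η L M)) (Gsq i)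
      (fun a b => B₀ * (torusGeom N η L M).len a ^ 2 *
        Real.exp (-(δ₀ * (torusGeom N η L M).dist a b))) := by
    intro i; simpa only [len_torusGeom] using h342_1 i
  have h342_2' : ∀ i, HasMajorantHom (g := toB6 (torusGeom N η L M) R H) (cblk (chart0 N η L M))
      (cblkY (chart0 N η L M)) (covD bsrc btgt (fun _ : UT N × Fin d => c₀) Rm ∘ₗ Gsq i)
      (fun a b => B₀ * (torusGeom N η L M).len a * Real.exp (-(δ₀ * (torusGeom N η L M).dist a b))) := by
    intro i; simpa only [len_torusGeom] using h342_2 i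
  have h := thm37_entry1_of_342_lattice_of_387_sz (g := torusGeom N η L M) (R := R) (H := H)
    (src := bsrc) (tgt := btgt) (c := fun _ : UT N × Fin d => c₀) (Rm := Rm) (Qf := mulOp q)
    (blk := cblk (chart0 N η L M)) (blkY := cblkY (chart0 N η L M)) (d := d) (Nd := d) (δ₀ := δ₀) (α := α)
    (ρ := ρ) (B₀ := B₀) (v₁ := |c₀| * (4 * d / (M₀ : ℝ)) * ((2 * ⌊ρ⌋₊ + 1 : ℝ) ^ d * η))
    (v₂ := c₀ ^ 2 * (52 * d / (M₀ : ℝ) ^ 2) * η ^ 2) (κQ := 0) (N := (5 : ℝ) ^ d) (N' := (7 : ℝ) ^ d)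
    (S := Sball (chart0 N η L M) M₀ M₀) (S' := Sball (chart0 N η L M) M₀ (M₀ + 1)) (hs := hSU N M₀)
    (θ := fun _ => |c₀| * (4 * d / (M₀ : ℝ))) (θ₂ := fun _ => c₀ ^ 2 * (52 * d / (M₀ : ℝ) ^ 2))
    (KQ := fun _ _ _ => 0) (G' := G') (Gsq := Gsq)
    (hRm := hRm) (hB₀ := hB₀) (hδ₀ := hδ₀.le) (hρ := zero_le_one.trans hρ) (hv₁ := by positivity)
    (hv₂ := by positivity) (hκQ := le_rfl) (hN := by positivity) (hN' := by positivity) (hαδ := hαδ)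
    (htri := htri_torusGeom η L M R H) (hrefl := hrefl_torusGeom η L M) (hdnn := hdnn_torusGeom η L M)
    (hlen := hlen_torusGeom η L M hη) (h261 := h261_torusGeom η L M R H hα hδ₀)
    (h263 := h263_torusGeom η L M R H hα hα1 hδ₀) (hsmall := hsmall') (hh := hh_torus M₀)
    (hS := hS_chart (chart0_injective η L M) hM) (hcnt := hcnt_chart (chart0_injective η L M) hM)
    (hcnt' := hcnt'_chart (chart0_injective η L M) hM) (hθ0 := hθ0_torus M₀ c₀) (hθ := hθ_torus hM c₀)
    (hθ₂0 := hθ₂0_torus M₀ c₀) (hθ₂ := hθ₂_torus hM h2N c₀) (hsupp := hsupp_chart (chart0_injective η L M) hM)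
    (hNs := hNs_torus) (hNt := hNt_torus) (hadj := hadj_of_nb (h0_chart0 η L M) (hnb_chart0 η L M) hρ)
    (hV₁ := hV₁_of_ge (hge_chart0 η L M) hη (len_chart0 η L M) (zero_le_one.trans hρ) c₀)
    (hV₂ := hV₂_chart (len_chart0 η L M) c₀) (hKQ := fun _ _ _ => le_rfl)
    (hlocQ := fun _ _ _ h => absurd rfl h) (hrowQ := hrowQ) (hsq := hsq_torus hM hdiv h2N)
    (h342_1 := h342_1') (h342_2 := h342_2')
    (hQ := fun i => hQ_diag (cblk (chart0 N η L M)) (hSU N M₀ i ∘ Prod.fst) q) (hloc := hloc) (hinv := hinv)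
  simp only [len_torusGeom, add_zero] at h
  exact h

end Entry1

/-! ## §3  Entry 2 of (3.42): |∇G′| with weight η -/

section Entry2

variable {Cp : Type}

/-- **Entry 2 of (3.42) for G′ = (Δ_U + Q′\*aQ′)^{−1} IN THE ONE-SCALE ℓ¹ TORUS MODEL** =
`B9Thm37GlueSz.thm37_entry2_of_342_lattice_of_387_sz` in the model of `thm37_entry1_l1_diag`, with the located
support of h_□∇_U read through `hSY_l1` (S_□ := S′_□, the chart ball of radius M₀ + 1, so N = N′ = 7^d) and
κ₄ := v₁ (`hV₃_l1`).  Remaining hypotheses (NOT asserted): compatibility, `hRm`, ranges, `hsmall`, Cor. 3.6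
(`h342_1`, `h342_2`), `hloc`, `hinv`. [cite: Balaban1985BackgroundPropagators, Thm 3.7 (3.87)–(3.90) pp.408–410 + (3.42) p.397; Balaban1984PropagatorsII, (2.14) p.225 + Lemma 2.1 p.234] -/
theorem thm37_entry2_l1_diag [Fintype Cp] [DecidableEq Cp] {M₀ : ℕ} (hM : 1 ≤ M₀) (hdiv : ∀ i, M₀ ∣ N i)
    (h2N : ∀ i, 2 * M₀ ≤ N i) (η L M R : ℝ) (H : Prop) (hη : 0 ≤ η) (c₀ : ℝ)
    (Rm : UT N × Fin d → Cp → Cp → ℝ) (q : UT N × Cp → ℝ) (δ₀ α ρ B₀ : ℝ) {G' : Module.End ℝ (UT N × Cp → ℝ)}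
    (hRm : ∀ b i j, ∑ k, Rm b k i * Rm b k j = if i = j then 1 else 0)
    (hB₀ : 0 ≤ B₀) (hδ₀ : 0 < δ₀) (hα : 0 < α) (hα1 : α ≤ 1) (hρ : 1 ≤ ρ)
    (hsmall : (7 : ℝ) ^ d * (B₀ * Real.exp (δ₀ * ρ) *
        ((d + d * Fintype.card Cp : ℝ) * (|c₀| * (4 * d / (M₀ : ℝ)) * ((2 * ⌊ρ⌋₊ + 1 : ℝ) ^ d * η)) +
          c₀ ^ 2 * (52 * d / (M₀ : ℝ) ^ 2) * η ^ 2)) * B6.c1 d δ₀ α < 1)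
    {Gsq : Ctr N M₀ → Module.End ℝ (UT N × Cp → ℝ)}
    (h342_1 : ∀ i, HasMajorant (g := toB6 (torusGeom N η L M) R H) (cblk (chart0 N η L M)) (Gsq i)
      (fun a b => B₀ * η ^ 2 * Real.exp (-(δ₀ * tdist1 N a b))))
    (h342_2 : ∀ i, HasMajorantHom (g := toB6 (torusGeom N η L M) R H) (cblk (chart0 N η L M))
      (cblkY (chart0 N η L M)) (covD bsrc btgt (fun _ : UT N × Fin d => c₀) Rm ∘ₗ Gsq i)
      (fun a b => B₀ * η * Real.exp (-(δ₀ * tdist1 N a b))))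
    (hloc : ∀ i, mulOp (hSU N M₀ i ∘ Prod.fst) *
      (covDT bsrc btgt (fun _ : UT N × Fin d => c₀) Rm ∘ₗ covD bsrc btgt (fun _ : UT N × Fin d => c₀) Rm +
        mulOp q) *
      Gsq i * mulOp (hSU N M₀ i ∘ Prod.fst) = mulOp (hSU N M₀ i ∘ Prod.fst) * mulOp (hSU N M₀ i ∘ Prod.fst))
    (hinv : G' * (covDT bsrc btgt (fun _ : UT N × Fin d => c₀) Rm ∘ₗ
      covD bsrc btgt (fun _ : UT N × Fin d => c₀) Rm + mulOp q) = 1) :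
    HasMajorantHom (g := toB6 (torusGeom N η L M) R H) (cblk (chart0 N η L M)) (cblkY (chart0 N η L M))
      (covD bsrc btgt (fun _ : UT N × Fin d => c₀) Rm ∘ₗ G')
      (fun (a b : UT N) => B₀ * ((7 : ℝ) ^ d + (7 : ℝ) ^ d * Real.exp (δ₀ * ρ) *
          (|c₀| * (4 * d / (M₀ : ℝ)) * ((2 * ⌊ρ⌋₊ + 1 : ℝ) ^ d * η))) * B6.c1 d δ₀ α *
        (1 - (7 : ℝ) ^ d * (B₀ * Real.exp (δ₀ * ρ) *
          ((d + d * Fintype.card Cp : ℝ) * (|c₀| * (4 * d / (M₀ : ℝ)) * ((2 * ⌊ρ⌋₊ + 1 : ℝ) ^ d * η)) +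
            c₀ ^ 2 * (52 * d / (M₀ : ℝ) ^ 2) * η ^ 2)) * B6.c1 d δ₀ α)⁻¹ * η *
        Real.exp (-((1 - α) * δ₀ * tdist1 N a b))) := by
  have hαδ : 0 ≤ (1 - α) * δ₀ := mul_nonneg (by linarith) hδ₀.le
  have hsmall' : (7 : ℝ) ^ d * (B₀ * Real.exp (δ₀ * ρ) *
      ((d + d * Fintype.card Cp : ℝ) * (|c₀| * (4 * d / (M₀ : ℝ)) * ((2 * ⌊ρ⌋₊ + 1 : ℝ) ^ d * η)) +
        (c₀ ^ 2 * (52 * d / (M₀ : ℝ) ^ 2) * η ^ 2 + 0))) * B6.c1 d δ₀ α < 1 := by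
    rw [add_zero]; exact hsmall
  have hrowQ : ∀ (i : Ctr N M₀) (a : (torusGeom N η L M).Site),
      ∑ y'' : (torusGeom N η L M).Site, (fun (_ : Ctr N M₀) (_ _ : (torusGeom N η L M).Site) => (0 : ℝ)) i a y'' *
          (torusGeom N η L M).len y'' ^ 2 ≤
        if a ∈ Sball (chart0 N η L M) M₀ (M₀ + 1) i then (0 : ℝ) else 0 := by
    intro i a
    rw [ite_self]
    exact le_of_eq (Finset.sum_eq_zero fun _ _ => by rw [zero_mul])
  have h342_1' : ∀ i, HasMajorant (g := toB6 (torusGeom N η L M) R H) (cblk (chart0 N η L M)) (Gsq i)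
      (fun a b => B₀ * (torusGeom N η L M).len a ^ 2 *
        Real.exp (-(δ₀ * (torusGeom N η L M).dist a b))) := by
    intro i; simpa only [len_torusGeom] using h342_1 i
  have h342_2' : ∀ i, HasMajorantHom (g := toB6 (torusGeom N η L M) R H) (cblk (chart0 N η L M))
      (cblkY (chart0 N η L M)) (covD bsrc btgt (fun _ : UT N × Fin d => c₀) Rm ∘ₗ Gsq i)
      (fun a b => B₀ * (torusGeom N η L M).len a * Real.exp (-(δ₀ * (torusGeom N η L M).dist a b))) := by
    intro i; simpa only [len_torusGeom] using h342_2 i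
  have h := thm37_entry2_of_342_lattice_of_387_sz (g := torusGeom N η L M) (R := R) (H := H)
    (src := bsrc) (tgt := btgt) (c := fun _ : UT N × Fin d => c₀) (Rm := Rm) (Qf := mulOp q)
    (blk := cblk (chart0 N η L M)) (blkY := cblkY (chart0 N η L M)) (d := d) (Nd := d) (δ₀ := δ₀) (α := α)
    (ρ := ρ) (B₀ := B₀) (v₁ := |c₀| * (4 * d / (M₀ : ℝ)) * ((2 * ⌊ρ⌋₊ + 1 : ℝ) ^ d * η))
    (v₂ := c₀ ^ 2 * (52 * d / (M₀ : ℝ) ^ 2) * η ^ 2) (κQ := 0)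
    (κ₄ := |c₀| * (4 * d / (M₀ : ℝ)) * ((2 * ⌊ρ⌋₊ + 1 : ℝ) ^ d * η)) (N := (7 : ℝ) ^ d) (N' := (7 : ℝ) ^ d)
    (S := Sball (chart0 N η L M) M₀ (M₀ + 1)) (S' := Sball (chart0 N η L M) M₀ (M₀ + 1)) (hs := hSU N M₀)
    (θ := fun _ => |c₀| * (4 * d / (M₀ : ℝ))) (θ₂ := fun _ => c₀ ^ 2 * (52 * d / (M₀ : ℝ) ^ 2))
    (KQ := fun _ _ _ => 0) (G' := G') (Gsq := Gsq)
    (hRm := hRm) (hB₀ := hB₀) (hδ₀ := hδ₀.le) (hρ := zero_le_one.trans hρ) (hv₁ := by positivity)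
    (hv₂ := by positivity) (hκQ := le_rfl) (hκ₄ := by positivity) (hN := by positivity) (hN' := by positivity)
    (hαδ := hαδ) (htri := htri_torusGeom η L M R H) (hrefl := hrefl_torusGeom η L M)
    (hdnn := hdnn_torusGeom η L M) (hlen := hlen_torusGeom η L M hη) (h261 := h261_torusGeom η L M R H hα hδ₀)
    (h263 := h263_torusGeom η L M R H hα hα1 hδ₀) (hsmall := hsmall') (hh := hh_torus M₀)
    (hSY := hSY_l1 η L M hM) (hcnt := hcnt'_chart (chart0_injective η L M) hM)
    (hcnt' := hcnt'_chart (chart0_injective η L M) hM) (hθ0 := hθ0_torus M₀ c₀) (hθ := hθ_torus hM c₀)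
    (hθ₂0 := hθ₂0_torus M₀ c₀) (hθ₂ := hθ₂_torus hM h2N c₀) (hsupp := hsupp_chart (chart0_injective η L M) hM)
    (hNs := hNs_torus) (hNt := hNt_torus) (hadj := hadj_of_nb (h0_chart0 η L M) (hnb_chart0 η L M) hρ)
    (hV₁ := hV₁_of_ge (hge_chart0 η L M) hη (len_chart0 η L M) (zero_le_one.trans hρ) c₀)
    (hV₂ := hV₂_chart (len_chart0 η L M) c₀) (hV₃ := hV₃_l1 η L M hη (zero_le_one.trans hρ) c₀)
    (hKQ := fun _ _ _ => le_rfl) (hlocQ := fun _ _ _ h => absurd rfl h) (hrowQ := hrowQ)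
    (hsq := hsq_torus hM hdiv h2N) (h342_1 := h342_1') (h342_2 := h342_2')
    (hQ := fun i => hQ_diag (cblk (chart0 N η L M)) (hSU N M₀ i ∘ Prod.fst) q) (hloc := hloc) (hinv := hinv)
  simp only [len_torusGeom, add_zero] at h
  exact h

end Entry2

/-! ## §4  Entry 3 of (3.42): |G′∇*| with weight η -/

section Entry3

variable {Cp : Type}

/-- **Entry 3 of (3.42) for G′ = (Δ_U + Q′\*aQ′)^{−1} IN THE ONE-SCALE ℓ¹ TORUS MODEL** =
`B9Thm37GlueSz.thm37_entry3_of_342_lattice_of_387_sz` in the model of `thm37_entry1_l1_diag`, with C_ℓ := 1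
(`hcomp_l1`: all lengths are η), w₁ := v₁ (`hC₁_l1`), the symmetric ℓ¹ distance (`hsym_torusGeom`), positive
lengths (`hlenpos_torusGeom`, hence 0 < η), K_Q := 0 (`hcolQ` trivial) and `hQt := isTransposePair_mulOp q`; the
decay rate is (1 − 2α)δ₀, so 0 < α ≤ ½.  Remaining hypotheses (NOT asserted): compatibility, `hRm`, ranges,
`hsmall` (the (1 + #Cp)-shape of the _sz theorem), Cor. 3.6 (`h342_1`, `h342_3`), the symmetry `hG` of the G′_□,
`hloc`, `hinv`. [cite: Balaban1985BackgroundPropagators, Thm 3.7 (3.87)–(3.90) pp.408–410 + (3.42) p.397; Balaban1984PropagatorsII, (2.14) p.225 + Lemma 2.1 p.234] -/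
theorem thm37_entry3_l1_diag [Fintype Cp] [DecidableEq Cp] {M₀ : ℕ} (hM : 1 ≤ M₀) (hdiv : ∀ i, M₀ ∣ N i)
    (h2N : ∀ i, 2 * M₀ ≤ N i) (η L M R : ℝ) (H : Prop) (hη : 0 < η) (c₀ : ℝ)
    (Rm : UT N × Fin d → Cp → Cp → ℝ) (q : UT N × Cp → ℝ) (δ₀ α ρ B₀ : ℝ) {G' : Module.End ℝ (UT N × Cp → ℝ)}
    (hRm : ∀ b i j, ∑ k, Rm b k i * Rm b k j = if i = j then 1 else 0)
    (hB₀ : 0 ≤ B₀) (hδ₀ : 0 < δ₀) (hα : 0 < α) (hα2 : 2 * α ≤ 1) (hρ : 1 ≤ ρ)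
    (hsmall : (7 : ℝ) ^ d * (B₀ * Real.exp (δ₀ * ρ) *
        ((1 + Fintype.card Cp : ℝ) * (|c₀| * (4 * d / (M₀ : ℝ)) * ((2 * ⌊ρ⌋₊ + 1 : ℝ) ^ d * η)) +
          c₀ ^ 2 * (52 * d / (M₀ : ℝ) ^ 2) * η ^ 2)) * B6.c1 d δ₀ α < 1)
    {Gsq : Ctr N M₀ → Module.End ℝ (UT N × Cp → ℝ)}
    (h342_1 : ∀ i, HasMajorant (g := toB6 (torusGeom N η L M) R H) (cblk (chart0 N η L M)) (Gsq i)
      (fun a b => B₀ * η ^ 2 * Real.exp (-(δ₀ * tdist1 N a b))))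
    (h342_3 : ∀ i, HasMajorantHom (g := toB6 (torusGeom N η L M) R H) (cblkY (chart0 N η L M))
      (cblk (chart0 N η L M)) (Gsq i ∘ₗ covDT bsrc btgt (fun _ : UT N × Fin d => c₀) Rm)
      (fun a b => B₀ * η * Real.exp (-(δ₀ * tdist1 N a b))))
    (hG : ∀ i, IsTransposePair (Gsq i) (Gsq i))
    (hloc : ∀ i, mulOp (hSU N M₀ i ∘ Prod.fst) *
      (covDT bsrc btgt (fun _ : UT N × Fin d => c₀) Rm ∘ₗ covD bsrc btgt (fun _ : UT N × Fin d => c₀) Rm +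
        mulOp q) *
      Gsq i * mulOp (hSU N M₀ i ∘ Prod.fst) = mulOp (hSU N M₀ i ∘ Prod.fst) * mulOp (hSU N M₀ i ∘ Prod.fst))
    (hinv : G' * (covDT bsrc btgt (fun _ : UT N × Fin d => c₀) Rm ∘ₗ
      covD bsrc btgt (fun _ : UT N × Fin d => c₀) Rm + mulOp q) = 1) :
    HasMajorantHom (g := toB6 (torusGeom N η L M) R H) (cblkY (chart0 N η L M)) (cblk (chart0 N η L M))
      (G' ∘ₗ covDT bsrc btgt (fun _ : UT N × Fin d => c₀) Rm)
      (fun (a b : UT N) => B₀ * ((5 : ℝ) ^ d + (7 : ℝ) ^ d * Real.exp (δ₀ * ρ) *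
          (d * (|c₀| * (4 * d / (M₀ : ℝ)) * ((2 * ⌊ρ⌋₊ + 1 : ℝ) ^ d * η)))) * B6.c1 d δ₀ α *
        (1 - (7 : ℝ) ^ d * (B₀ * Real.exp (δ₀ * ρ) *
          ((1 + Fintype.card Cp : ℝ) * (|c₀| * (4 * d / (M₀ : ℝ)) * ((2 * ⌊ρ⌋₊ + 1 : ℝ) ^ d * η)) +
            c₀ ^ 2 * (52 * d / (M₀ : ℝ) ^ 2) * η ^ 2)) * B6.c1 d δ₀ α)⁻¹ * η *
        Real.exp (-((1 - 2 * α) * δ₀ * tdist1 N a b))) := by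
  have hα1 : α ≤ 1 := by linarith
  have hαδ : 0 ≤ α * δ₀ := mul_nonneg hα.le hδ₀.le
  have hαδ2 : 0 ≤ (1 - 2 * α) * δ₀ := mul_nonneg (by linarith) hδ₀.le
  have hsmall' : (7 : ℝ) ^ d * (B₀ * Real.exp (δ₀ * ρ) *
      ((1 + Fintype.card Cp : ℝ) * (|c₀| * (4 * d / (M₀ : ℝ)) * ((2 * ⌊ρ⌋₊ + 1 : ℝ) ^ d * η)) +
        1 * (c₀ ^ 2 * (52 * d / (M₀ : ℝ) ^ 2) * η ^ 2 + 0))) * B6.c1 d δ₀ α < 1 := by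
    rw [add_zero, one_mul]; exact hsmall
  have hcolQ : ∀ (i : Ctr N M₀) (b : (torusGeom N η L M).Site),
      (∑ y'' : (torusGeom N η L M).Site, (fun (_ : Ctr N M₀) (_ _ : (torusGeom N η L M).Site) => (0 : ℝ)) i y'' b) *
          (torusGeom N η L M).len b ^ 2 ≤
        if b ∈ Sball (chart0 N η L M) M₀ (M₀ + 1) i then (0 : ℝ) else 0 := by
    intro i b
    rw [ite_self, Finset.sum_eq_zero fun _ _ => rfl, zero_mul]
  have h342_1' : ∀ i, HasMajorant (g := toB6 (torusGeom N η L M) R H) (cblk (chart0 N η L M)) (Gsq i)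
      (fun a b => B₀ * (torusGeom N η L M).len a ^ 2 *
        Real.exp (-(δ₀ * (torusGeom N η L M).dist a b))) := by
    intro i; simpa only [len_torusGeom] using h342_1 i
  have h342_3' : ∀ i, HasMajorantHom (g := toB6 (torusGeom N η L M) R H) (cblkY (chart0 N η L M))
      (cblk (chart0 N η L M)) (Gsq i ∘ₗ covDT bsrc btgt (fun _ : UT N × Fin d => c₀) Rm)
      (fun a b => B₀ * (torusGeom N η L M).len a * Real.exp (-(δ₀ * (torusGeom N η L M).dist a b))) := by
    intro i; simpa only [len_torusGeom] using h342_3 i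
  have h := thm37_entry3_of_342_lattice_of_387_sz (g := torusGeom N η L M) (R := R) (H := H)
    (blk := cblk (chart0 N η L M)) (blkY := cblkY (chart0 N η L M)) (src := bsrc) (tgt := btgt)
    (c := fun _ : UT N × Fin d => c₀) (Rm := Rm) (Qf := mulOp q) (d := d) (Nd := d) (δ₀ := δ₀) (α := α)
    (ρ := ρ) (B₀ := B₀) (w₁ := |c₀| * (4 * d / (M₀ : ℝ)) * ((2 * ⌊ρ⌋₊ + 1 : ℝ) ^ d * η))
    (v₂ := c₀ ^ 2 * (52 * d / (M₀ : ℝ) ^ 2) * η ^ 2) (κQ := 0) (Cℓ := 1) (N := (5 : ℝ) ^ d)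
    (N' := (7 : ℝ) ^ d) (S := Sball (chart0 N η L M) M₀ M₀) (S' := Sball (chart0 N η L M) M₀ (M₀ + 1))
    (hs := hSU N M₀) (θ := fun _ => |c₀| * (4 * d / (M₀ : ℝ))) (θ₂ := fun _ => c₀ ^ 2 * (52 * d / (M₀ : ℝ) ^ 2))
    (KQ := fun _ _ _ => 0) (G' := G') (Gsq := Gsq)
    (hRm := hRm) (hB₀ := hB₀) (hδ₀ := hδ₀.le) (hρ := zero_le_one.trans hρ) (hw₁ := by positivity)
    (hv₂ := by positivity) (hκQ := le_rfl) (hCℓ := zero_le_one) (hN := by positivity) (hN' := by positivity)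
    (hαδ := hαδ) (hαδ2 := hαδ2) (htri := htri_torusGeom η L M R H) (hrefl := hrefl_torusGeom η L M)
    (hsym := hsym_torusGeom η L M) (hdnn := hdnn_torusGeom η L M) (hlenpos := hlenpos_torusGeom η L M hη)
    (h261 := h261_torusGeom η L M R H hα hδ₀) (h263 := h263_torusGeom η L M R H hα hα1 hδ₀)
    (hsmall := hsmall') (hh := hh_torus M₀) (hS := hS_chart (chart0_injective η L M) hM)
    (hcnt := hcnt_chart (chart0_injective η L M) hM) (hcnt' := hcnt'_chart (chart0_injective η L M) hM)
    (hcomp := hcomp_l1 η L M) (hθ0 := hθ0_torus M₀ c₀) (hθ := hθ_torus hM c₀) (hθ₂0 := hθ₂0_torus M₀ c₀)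
    (hθ₂ := hθ₂_torus hM h2N c₀) (hsupp := hsupp_chart (chart0_injective η L M) hM) (hNs := hNs_torus)
    (hadj := hadj_of_nb (h0_chart0 η L M) (hnb_chart0 η L M) hρ)
    (hC₁ := hC₁_l1 η L M hη.le (zero_le_one.trans hρ) c₀) (hV₂ := hV₂_chart (len_chart0 η L M) c₀)
    (hKQ := fun _ _ _ => le_rfl) (hlocQ := fun _ _ _ h => absurd rfl h) (hcolQ := hcolQ)
    (hsq := hsq_torus hM hdiv h2N) (h342_1 := h342_1') (h342_3 := h342_3')
    (hQ := fun i => hQ_diag (cblk (chart0 N η L M)) (hSU N M₀ i ∘ Prod.fst) q)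
    (hQt := isTransposePair_mulOp q) (hG := hG) (hloc := hloc) (hinv := hinv)
  simp only [len_torusGeom, add_zero, one_mul, mul_one] at h
  exact h

end Entry3

end

end Literature.MathematicalPhysics.QuantumFieldTheory.Balaban1983to89.B9Thm37GlueTorusE123
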